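import Mathlib.LinearAlgebra.Dimension.Localization
import Mathlib.LinearAlgebra.Dimension.RankNullity
import Mathlib.LinearAlgebra.Dimension.Constructions
import Mathlib.LinearAlgebra.FreeModule.PID
import Mathlib.LinearAlgebra.Pi
import Mathlib.RingTheory.Noetherian.Basic
import Mathlib.Algebra.EuclideanDomain.Int
import HarnessLib

/-!
# Crux `FrobeniusLadder.FRationalResolution` (stmt-ResolutionOfSingularities-15317), line `redirect`,
# stub `stub_diagonalizableQuotientResolution` — the RANK IDENTITY of the «sharpening» step (third brick for WILD non-fixed points,
# memo MEMO-15317-leafhand4-g1 §remaining (1); hypothesis `hrank` of `…LogChartUnitTransfer.isLogRegularAt_iff_of_units` ✓ p825267)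

Generic `ℤ`-linear algebra. Split `ℤᴺ = ℤⁿ ⊕ ℤᵐ` along `e : Fin n ⊕ Fin m ≃ Fin N` and let `π : ℤᴺ → ℤⁿ` be the projection. If a set
`F ⊆ ℤᴺ` projects ONTO `F' ⊆ ℤⁿ` and contains, for every `j`, a non-zero multiple `d_j e_{inr j}` of the `j`-th vertical basis vector
(downstream: `F = F_𝔭(ψ)` the face of the unit-exponent chart, which contains `(0, ord(c_j) e_j)`, and `F' = F_𝔭(ψ♯)` the face of the
sharpened chart), then `rk ℤF = rk ℤF' + m`, i.e. `N − rk ℤF = n − rk ℤF'`.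

* `finrank_ker_proj` — the projection `ℤᴺ → ℤⁿ` has kernel of rank `m`;
* **`finrank_span_eq_finrank_span_proj_add`** — `finrank (span F) = finrank (span F') + m`;
* `rank_term_eq` — `N − finrank (span F) = n − finrank (span F')`.

Honest label: bookkeeping brick (no stub closed). No definitions, no named facts, no sorry. [folklore; cite: Kato1994, Def. (2.1)]
-/

-- single-problem summit: the doubled namespace component is forced
set_option linter.dupNamespace false

namespace Summit.ResolutionOfSingularities.ResolutionOfSingularities.Theorems.FRationalResolution.SharpRank

open Module

variable {N n m : ℕ}

/-- `n + m = N` from the splitting. [folklore] -/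
theorem card_eq (e : Fin n ⊕ Fin m ≃ Fin N) : n + m = N := by
  have h := Fintype.card_congr e
  simpa using h

/-- **The projection `ℤᴺ → ℤⁿ` onto the `inl`-coordinates has kernel of rank `m`.** [folklore] -/
theorem finrank_ker_proj (e : Fin n ⊕ Fin m ≃ Fin N) :
    finrank ℤ (LinearMap.ker (LinearMap.funLeft ℤ ℤ (fun i : Fin n => e (Sum.inl i)))) = m := by
  classical
  set π : (Fin N → ℤ) →ₗ[ℤ] (Fin n → ℤ) := LinearMap.funLeft ℤ ℤ (fun i : Fin n => e (Sum.inl i)) with hπ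
  have hsurj : Function.Surjective π := by
    intro w
    refine ⟨fun l => Sum.elim w 0 (e.symm l), funext fun i => ?_⟩
    simp [hπ, LinearMap.funLeft_apply]
  have h1 := (LinearMap.ker π).finrank_quotient_add_finrank
  rw [LinearEquiv.finrank_eq π.quotKerEquivRange, LinearMap.range_eq_top.mpr hsurj, finrank_top,
    Module.finrank_fin_fun, Module.finrank_fin_fun] at h1
  have hN := card_eq e
  omega

/-- **Rank identity**: if `F ⊆ ℤᴺ` projects onto `F' ⊆ ℤⁿ` and contains a non-zero multiple of each vertical basis vector
`e_{inr j}`, then `rk ℤF = rk ℤF' + m`. [folklore; cite: Kato1994, Def. (2.1)] -/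
theorem finrank_span_eq_finrank_span_proj_add (e : Fin n ⊕ Fin m ≃ Fin N) (F : Set (Fin N → ℤ)) (F' : Set (Fin n → ℤ))
    (hproj : (fun v : Fin N → ℤ => fun i => v (e (Sum.inl i))) '' F = F')
    (d : Fin m → ℤ) (hd : ∀ j, d j ≠ 0)
    (hvert : ∀ j, (fun l => if l = e (Sum.inr j) then d j else 0) ∈ F) :
    finrank ℤ (Submodule.span ℤ F) = finrank ℤ (Submodule.span ℤ F') + m := by
  classical
  set π : (Fin N → ℤ) →ₗ[ℤ] (Fin n → ℤ) := LinearMap.funLeft ℤ ℤ (fun i : Fin n => e (Sum.inl i)) with hπ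
  have hπapply : ∀ v : Fin N → ℤ, π v = fun i => v (e (Sum.inl i)) := fun v => rfl
  set S := Submodule.span ℤ F with hS
  set S' := Submodule.span ℤ F' with hS'
  have hπF : (π : (Fin N → ℤ) → (Fin n → ℤ)) '' F = F' := by
    rw [← hproj]
    exact Set.image_congr' hπapply
  have hmap : S.map π = S' := by
    rw [hS, Submodule.map_span, hπF]
  -- rank-nullity for `π|_S`
  set g := π.domRestrict S with hg
  have hrange : LinearMap.range g = S' := by rw [hg, LinearMap.range_domRestrict, hmap]
  have h1 := (LinearMap.ker g).finrank_quotient_add_finrank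
  rw [LinearEquiv.finrank_eq g.quotKerEquivRange, hrange] at h1
  -- `finrank (ker g) = m`
  suffices hker : finrank ℤ (LinearMap.ker g) = m by omega
  apply le_antisymm
  · -- `ker g ↪ ker π`
    have hle : (LinearMap.ker g).map S.subtype ≤ LinearMap.ker π := by
      rintro _ ⟨x, hx, rfl⟩
      have hx' : π (x : Fin N → ℤ) = 0 := hx
      exact hx'
    calc finrank ℤ (LinearMap.ker g)
        = finrank ℤ ((LinearMap.ker g).map S.subtype) := (Submodule.finrank_map_subtype_eq S _).symm
      _ ≤ finrank ℤ (LinearMap.ker π) := Submodule.finrank_mono hle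
      _ = m := finrank_ker_proj e
  · -- `m` independent vertical vectors in `ker g`
    let z : Fin m → (Fin N → ℤ) := fun j l => if l = e (Sum.inr j) then d j else 0
    have hzS : ∀ j, z j ∈ S := fun j => Submodule.subset_span (hvert j)
    have hzπ : ∀ j, π (z j) = 0 := fun j => by
      rw [hπapply]
      funext i
      have hne : e (Sum.inl i) ≠ e (Sum.inr j) := fun h => Sum.inl_ne_inr (e.injective h)
      simp [z, hne]
    let zf : Fin m → LinearMap.ker g := fun j =>
      ⟨⟨z j, hzS j⟩, by rw [LinearMap.mem_ker, hg, LinearMap.domRestrict_apply]; exact hzπ j⟩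
    have hzf : ∀ j, (((zf j : LinearMap.ker g) : S) : Fin N → ℤ) = z j := fun j => rfl
    have hli : LinearIndependent ℤ zf := by
      rw [Fintype.linearIndependent_iff]
      intro c hc k
      have h := congrArg (fun x : LinearMap.ker g => ((x : S) : Fin N → ℤ) (e (Sum.inr k))) hc
      simp only [Submodule.coe_sum, Submodule.coe_smul, Finset.sum_apply, Pi.smul_apply, hzf, smul_eq_mul,
        Submodule.coe_zero, Pi.zero_apply] at h
      have hsum : ∑ j, c j * z j (e (Sum.inr k)) = c k * d k := by
        rw [Finset.sum_eq_single k]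
        · simp [z]
        · intro j _ hjk
          have hne : e (Sum.inr k) ≠ e (Sum.inr j) := fun h' => hjk (Sum.inr_injective (e.injective h')).symm
          simp [z, hne]
        · intro hk; exact absurd (Finset.mem_univ k) hk
      rw [hsum] at h
      exact (mul_eq_zero.mp h).resolve_right (hd k)
    have h := hli.fintype_card_le_finrank
    simpa using h

/-- **The rank terms of Kato's (2.1)(ii) agree**: `N − rk ℤF = n − rk ℤF'` (the form consumed by
`…LogChartUnitTransfer.isLogRegularAt_iff_of_units`). [cite: Kato1994, Def. (2.1)] -/
theorem rank_term_eq (e : Fin n ⊕ Fin m ≃ Fin N) (F : Set (Fin N → ℤ)) (F' : Set (Fin n → ℤ))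
    (hproj : (fun v : Fin N → ℤ => fun i => v (e (Sum.inl i))) '' F = F')
    (d : Fin m → ℤ) (hd : ∀ j, d j ≠ 0)
    (hvert : ∀ j, (fun l => if l = e (Sum.inr j) then d j else 0) ∈ F) :
    N - finrank ℤ (Submodule.span ℤ F) = n - finrank ℤ (Submodule.span ℤ F') := by
  rw [finrank_span_eq_finrank_span_proj_add e F F' hproj d hd hvert, ← card_eq e]
  omega

end Summit.ResolutionOfSingularities.ResolutionOfSingularities.Theorems.FRationalResolution.SharpRank
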